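import Mathlib
import HarnessLib
import Literature.Analysis.FluidPDE.OctahedralSymmetry

/-!
# Glue lemmas for the line `thales-slit-exact-cone-type` of crux `PencilRigidity.ShellRigidity`
(stmt-QuantumFields-11685; second line lead)

Bookkeeping used by the composition `ShellRigidity_of` of the line skeleton
`Cruxes/ShellRigidity/Lines/thales-slit-exact-cone-type.lean`: invariance of a `W(B₄)`-symmetric kernel under
explicitly given signed permutations (through the tree's `Literature.Analysis.FluidPDE.signedPermIsometry`),
coordinates and norms of vectors of `ℝ⁴` given by four entries, the 45° rotation
`R₋₄₅ (x₀,x₁,x₂,x₃) = ((x₀+x₁)/√2, (x₁-x₀)/√2, x₂, x₃)` (norm-preserving, continuous), the symmetry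
hypotheses of the landed `stub_axisLaplace` / `stub_angleBandLimit` in coordinate form, polar coordinates in a
plane, `⟪e₁ b, p⟫ = b p₁`, and the swap of the coordinates `0,1`. All folklore; no definitions.
-/

noncomputable section

namespace Summit.QuantumFields.YangMills.Cruxes.ShellRigidity.ThalesSlitExactConeType

open MeasureTheory Complex Real
open scoped InnerProductSpace BigOperators
open Literature.Analysis.FluidPDE (signedPermIsometry signedPermIsometry_apply
  isSignedPermIsometry_signedPermIsometry)

local notation "E4" => EuclideanSpace ℝ (Fin 4)

/-! ## Glue I — signed permutations, the 45° rotation, coordinates -/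

/-- `K` is invariant under the signed permutation `(σ, s)`. [bookkeeping] -/
theorem K_signedPerm {K : E4 → ℝ}
    (hW : ∀ R : E4 ≃ₗᵢ[ℝ] E4, (∀ i : Fin 4, ∃ j : Fin 4,
        R (EuclideanSpace.single i 1) = EuclideanSpace.single j 1 ∨
        R (EuclideanSpace.single i 1) = -EuclideanSpace.single j 1) → ∀ x : E4, K (R x) = K x)
    (σ : Equiv.Perm (Fin 4)) (s : Fin 4 → ℤˣ) (x : E4) :
    K (signedPermIsometry σ s x) = K x :=
  hW _ (isSignedPermIsometry_signedPermIsometry σ s) x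

/-- A vector of `ℝ⁴` given by its four coordinates. [bookkeeping] -/
theorem eq_mk4 (x : E4) : x = WithLp.toLp 2 ![x 0, x 1, x 2, x 3] := by
  ext i; fin_cases i <;> rfl

/-- Coordinate `0` of a vector given by four entries. [bookkeeping] -/
@[simp] theorem mk4_apply_zero (a b c d : ℝ) : (WithLp.toLp 2 ![a, b, c, d] : E4) 0 = a := rfl
/-- Coordinate `1` of a vector given by four entries. [bookkeeping] -/
@[simp] theorem mk4_apply_one (a b c d : ℝ) : (WithLp.toLp 2 ![a, b, c, d] : E4) 1 = b := rfl
/-- Coordinate `2` of a vector given by four entries. [bookkeeping] -/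
@[simp] theorem mk4_apply_two (a b c d : ℝ) : (WithLp.toLp 2 ![a, b, c, d] : E4) 2 = c := rfl
/-- Coordinate `3` of a vector given by four entries. [bookkeeping] -/
@[simp] theorem mk4_apply_three (a b c d : ℝ) : (WithLp.toLp 2 ![a, b, c, d] : E4) 3 = d := rfl

/-- Invariance of `K` under an explicitly given signed permutation, coordinate form: if
`y j = s j * x (σ j)` for all `j` then `K y = K x`. [bookkeeping] -/
theorem K_of_coords {K : E4 → ℝ}
    (hW : ∀ R : E4 ≃ₗᵢ[ℝ] E4, (∀ i : Fin 4, ∃ j : Fin 4,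
        R (EuclideanSpace.single i 1) = EuclideanSpace.single j 1 ∨
        R (EuclideanSpace.single i 1) = -EuclideanSpace.single j 1) → ∀ x : E4, K (R x) = K x)
    (σ : Equiv.Perm (Fin 4)) (s : Fin 4 → ℤˣ) (x y : E4)
    (h : ∀ j : Fin 4, y j = ((s j : ℤ) : ℝ) * x (σ j)) : K y = K x := by
  have : y = signedPermIsometry σ s x := by
    ext j; rw [signedPermIsometry_apply]; exact h j
  rw [this, K_signedPerm hW]

/-- The norm of a vector of `ℝ⁴` in coordinates. [bookkeeping] -/
theorem norm_mk4 (a b c d : ℝ) :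
    ‖(WithLp.toLp 2 ![a, b, c, d] : E4)‖ = Real.sqrt (a ^ 2 + b ^ 2 + c ^ 2 + d ^ 2) := by
  rw [EuclideanSpace.norm_eq, Fin.sum_univ_four]
  simp [sq_abs]

/-- The norm of a vector of `ℝ⁴` in its own coordinates. [bookkeeping] -/
theorem norm_eq_sqrt4 (x : E4) : ‖x‖ = Real.sqrt (x 0 ^ 2 + x 1 ^ 2 + x 2 ^ 2 + x 3 ^ 2) := by
  conv_lhs => rw [eq_mk4 x]
  exact norm_mk4 _ _ _ _

/-- The 45° rotation `R₋₄₅ (x₀,x₁,x₂,x₃) = ((x₀+x₁)/√2, (x₁-x₀)/√2, x₂, x₃)` preserves the norm. [bookkeeping] -/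
theorem norm_rot45 (x : E4) :
    ‖(WithLp.toLp 2 ![(x 0 + x 1) / Real.sqrt 2, (x 1 - x 0) / Real.sqrt 2, x 2, x 3] : E4)‖ = ‖x‖ := by
  rw [norm_mk4, norm_eq_sqrt4]
  congr 1
  have h2 : Real.sqrt 2 ^ 2 = 2 := Real.sq_sqrt (by norm_num)
  field_simp
  rw [h2]; ring

/-- The 45° rotation is continuous. [bookkeeping] -/
theorem continuous_rot45 :
    Continuous fun x : E4 =>
      (WithLp.toLp 2 ![(x 0 + x 1) / Real.sqrt 2, (x 1 - x 0) / Real.sqrt 2, x 2, x 3] : E4) := by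
  have h : ∀ i : Fin 4, Continuous fun x : E4 => x i := fun i => (PiLp.continuous_apply 2 _ i)
  refine (PiLp.continuous_toLp 2 _).comp ?_
  refine continuous_pi fun i => ?_
  fin_cases i <;> simp <;> fun_prop

/-! ## Glue II — the rotated kernel `K' = K ∘ R₋₄₅` satisfies the axis-frame hypotheses -/

section Rotated

variable {K : E4 → ℝ}
  (hW : ∀ R : E4 ≃ₗᵢ[ℝ] E4, (∀ i : Fin 4, ∃ j : Fin 4,
      R (EuclideanSpace.single i 1) = EuclideanSpace.single j 1 ∨
      R (EuclideanSpace.single i 1) = -EuclideanSpace.single j 1) → ∀ x : E4, K (R x) = K x)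

include hW in
/-- `θ`-invariance in the hypothesis form of `stub_axisLaplace`. [bookkeeping] -/
theorem hθ_of_hW : ∀ x y : E4, y 0 = -x 0 → y 1 = x 1 → y 2 = x 2 → y 3 = x 3 → K y = K x := by
  intro x y h0 h1 h2 h3
  refine K_of_coords hW 1 (![(-1 : ℤˣ), 1, 1, 1]) x y fun j => ?_
  fin_cases j <;> simp [h0, h1, h2, h3]

include hW in
/-- Spatial parity in the hypothesis form of `stub_axisLaplace`. [bookkeeping] -/
theorem hP_of_hW : ∀ x y : E4, y 0 = x 0 → y 1 = -x 1 → y 2 = -x 2 → y 3 = -x 3 → K y = K x := by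
  intro x y h0 h1 h2 h3
  refine K_of_coords hW 1 (![(1 : ℤˣ), -1, -1, -1]) x y fun j => ?_
  fin_cases j <;> simp [h0, h1, h2, h3]

include hW in
/-- `R_{π/2}`-invariance: `K(-x₁, x₀, x₂, x₃) = K x`. [bookkeeping] -/
theorem hrot_of_hW : ∀ x : E4, K (WithLp.toLp 2 ![-x 1, x 0, x 2, x 3]) = K x := by
  intro x
  refine K_of_coords hW (Equiv.swap 0 1) (![(-1 : ℤˣ), 1, 1, 1]) x _ fun j => ?_
  fin_cases j <;> simp [Equiv.swap_apply_def]

include hW in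
/-- `x₁ ↦ -x₁`: `K(x₀, -x₁, x₂, x₃) = K x`. [bookkeeping] -/
theorem hflip1_of_hW : ∀ x : E4, K (WithLp.toLp 2 ![x 0, -x 1, x 2, x 3]) = K x := by
  intro x
  refine K_of_coords hW 1 (![(1 : ℤˣ), -1, 1, 1]) x _ fun j => ?_
  fin_cases j <;> simp

include hW in
/-- swap of `0,1`: `K(x₁, x₀, x₂, x₃) = K x`. [bookkeeping] -/
theorem hswap01_of_hW : ∀ x : E4, K (WithLp.toLp 2 ![x 1, x 0, x 2, x 3]) = K x := by
  intro x
  refine K_of_coords hW (Equiv.swap 0 1) (![(1 : ℤˣ), 1, 1, 1]) x _ fun j => ?_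
  fin_cases j <;> simp [Equiv.swap_apply_def]

include hW in
/-- `(x₀,x₁) ↦ (-x₁,-x₀)` with `(x₂,x₃) ↦ (-x₂,-x₃)`. [bookkeeping] -/
theorem hnegswapP_of_hW : ∀ x : E4, K (WithLp.toLp 2 ![-x 1, -x 0, -x 2, -x 3]) = K x := by
  intro x
  refine K_of_coords hW (Equiv.swap 0 1) (![(-1 : ℤˣ), -1, -1, -1]) x _ fun j => ?_
  fin_cases j <;> simp [Equiv.swap_apply_def]

include hW in
/-- `(x₀,x₁) ↦ (-x₁,-x₀)`. [bookkeeping] -/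
theorem hnegswap_of_hW : ∀ x : E4, K (WithLp.toLp 2 ![-x 1, -x 0, x 2, x 3]) = K x := by
  intro x
  refine K_of_coords hW (Equiv.swap 0 1) (![(-1 : ℤˣ), -1, 1, 1]) x _ fun j => ?_
  fin_cases j <;> simp [Equiv.swap_apply_def]

end Rotated


/-! ## Glue III — small analytic facts -/

/-- Polar form of a planar vector of radius `r > 0`. [bookkeeping] -/
theorem exists_polar {p q r : ℝ} (hr : 0 < r) (h : p ^ 2 + q ^ 2 = r ^ 2) :
    ∃ φ : ℝ, p = r * Real.cos φ ∧ q = r * Real.sin φ := by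
  set w : ℂ := ⟨p, q⟩ with hw
  have hnorm : ‖w‖ = r := by
    rw [Complex.norm_def, Complex.normSq_mk, ← sq, ← sq, h]
    exact Real.sqrt_sq hr.le
  have hw0 : w ≠ 0 := by
    intro h0; rw [h0, norm_zero] at hnorm; linarith
  refine ⟨Complex.arg w, ?_, ?_⟩
  · have := Complex.cos_arg hw0
    rw [hnorm] at this
    field_simp at this
    simpa [hw, mul_comm] using this.symm
  · have := Complex.sin_arg w
    rw [hnorm] at this
    field_simp at this
    simpa [hw, mul_comm] using this.symm

/-- `⟪single 1 b, p⟫ = b * p 1`. [bookkeeping] -/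
theorem inner_single_one (b : ℝ) (p : E4) :
    ⟪(EuclideanSpace.single 1 b : E4), p⟫_ℝ = b * p 1 := by
  rw [EuclideanSpace.inner_single_left]; simp

/-- The swap of the coordinates `0, 1` in coordinates. [bookkeeping] -/
theorem swap01_apply (u : E4) (k : Fin 4) :
    LinearIsometryEquiv.piLpCongrLeft 2 ℝ ℝ (Equiv.swap (0 : Fin 4) 1) u k = u (Equiv.swap (0 : Fin 4) 1 k) := by
  fin_cases k <;> simp [LinearIsometryEquiv.piLpCongrLeft_apply, Equiv.swap_apply_def]

end Summit.QuantumFields.YangMills.Cruxes.ShellRigidity.ThalesSlitExactConeType
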